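import Literature.NumberTheory.ComplexMultiplication.CosetGermGaloisCMTypes
import HarnessLib

/-!
# Milne 1999 §6 p. 69 L26–L28, p. 70 L7–L8: «`Π = {π₀, …, π_{(n/d)−1}, ιπ₀, …, ιπ_{(n/d)−1}}` is a `Γ`-orbit in `X^*(P^K)`» and
# «the map `τ ↦ τπ₀` defines a bijection `Γ/D → Π`, and hence an isomorphism `ℤ[Γ/D] → ℤ[Π]`» — in the model and for the CM field `K`

THE PRINT. [Milne1999, §6 p. 69 L22–L28]: «Let `ψ_i = τ_i + Σ_{j≠i} ιτ_j` … As `τ_iψ₀ = ψ_i`, `(ιτ_i)ψ₀ = ιψ_i` we see that `Ψ = {ψ₀, …, ψ_{n−1},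
ιψ₀, …, ιψ_{n−1}}` is a `Γ`-orbit in `X^*(S^K)`.  Let `π_i = π(ψ_{id}) ∈ W^K_{1,+}(p^∞)`.  Then `Π = {π₀, …, π_{(n/d)−1}, ιπ₀, …, ιπ_{(n/d)−1}}`
is a `Γ`-orbit in `X^*(P^K)`.»  [p. 70 L7–L8, proof of Lemma 6.7]: «The map `τ ↦ τπ₀` defines a bijection `Γ/D → Π`, and hence an
isomorphism `ℤ[Γ/D] → ℤ[Π]`.»  Here (p. 69 L1–L17) `K = Q·F ≠ Q`, `Γ = Gal(K/ℚ) = Γ₀ × ⟨ι⟩`, `n = |Γ₀| = [F : ℚ]`, `D = D(w₀) ⊂ Γ₀`,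
`d = (D : 1)`, and (p. 70 L12–L16) `π_i` has germ `ϖ_i = σ_i + dισ₀ + ⋯ + (d−1)ισ_i + ⋯ + dισ_{(n/d)−1} ∈ ℤ[Γ/D]`, `σ_i = τ_{di}D`.

DICTIONARY (tree ↔ print).  The model (g17-#1…#5, namespace `CosetGerm`): `Setting ι Γ₀ D` = «`Γ = Γ₀ × ⟨ι⟩`, `D ⊂ Γ₀`»; `psiType h` = the
CM type of `ψ₀` (`{1} ∪ ι(Γ₀∖{1})`), `τ • psiType h` = that of `ψ_τ = τψ₀`; `red R h Φ = push(𝟙_Φ) ∈ WeilGerms R h ⊂ R[Γ/D]` = `π(Φ)` read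
through the injection `π ↦ f_π` («it is injective (Section 4)»); `halfCosets Γ₀ D` = «the `σ_i`»; `Fintype.card D` = `d`;
`(univ.filter (· ∈ Γ₀)).card` = `n`.  HERE: **`piGerm R h τ := red R h (τ • psiType h)`** = «`π_i = π(ψ_{id})`» (for every `τ ∈ Γ`; `π₀ =
piGerm R h 1`), its orbit `MulAction.orbit Γ (piGerm R h 1)` = «`Π`», and **`quotientEquivOrbit : Γ ⧸ D ≃ Π`** = «`τ ↦ τπ₀` … a bijection
`Γ/D → Π`».  The number field (g15/g16/g18, namespace `CMNumbers`): `X^*(P^K) = Additive (weilLimitIn K p τ₀)` with `Gal(ℚ^{cm}/ℚ)` acting by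
`weilLimitInRep`; `X^*(α^K) = alphaCharIn`; `λ_Φ = cmTypeChar`; g18-#2 `germToCosetFun : X^*(P^K) ↪ ℤ[Γ/D]`, `π ↦ f_π` («The map at right
sends `π` to the map `σ ↦ f_π(σw₀)`»); g18-#3 `ofCMTypes τ₀ h` reads a CM type on `Γ` as a CM type of `K`.  HERE: **`piZero p 𝔭 τ₀ h :=
alphaCharIn (cmTypeChar (Φ₀))`**, `Φ₀ = ofCMTypes τ₀ h (psiType h) = {τ₀} ∪ {τ₀ιτ | τ ∈ Γ₀, τ ≠ 1}` = «`π₀ = π(ψ₀)`» IN `X^*(P^K)`, and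
**`weilOrbitPiZero`** = its `Gal(ℚ^{cm}/ℚ)`-orbit = «`Π` … a `Γ`-orbit in `X^*(P^K)`».

WHAT IS HERE.  §1 (model, any commutative `R`): DEF `piGerm`; `coe_piGerm`/`coe_iota_smul_piGerm` (the germs `ϖ_τ`, `ιϖ_τ`, from g17-#2
`pushFun_psi`, `pushFun_act_iota_psi`); **`smul_piGerm : γ·π_τ = π_{γτ}`** («`τ_iψ₀ = ψ_i`, `(ιτ_i)ψ₀ = ιψ_i`» pushed to `X^*(P^K)`: `Π = Γπ₀`,
`mem_orbit_piGerm_one_iff`); the four values `ϖ_τ(τ₁D) = [τD = τ₁D]`, `ϖ_τ(ιτ₁D) = d − [τD = τ₁D]`, `(ιϖ_τ)(τ₁D) = d − [τD = τ₁D]`,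
`(ιϖ_τ)(ιτ₁D) = [τD = τ₁D]`; `piGerm_eq_piGerm_iff : π_τ = π_{τ′} ⟺ τD = τ′D` (`τ, τ′ ∈ Γ₀`, `R` nontrivial); `smul_piGerm_one_of_mem` (`D` fixes
`π₀`); **`smul_piGerm_one_eq_iff : γπ₀ = π₀ ⟺ γ ∈ D`** and **`stabilizer_piGerm_one : Stab_Γ(π₀) = D`** (`R` of characteristic `0`, `n ≠ 2`);
`germ_eq_coe_piGerm`/`germ_eq_coe_quotientToOrbit` (g17-#3's `germ`, the basis values of its `X^*(β) = betaPi`, IS `τD ↦ f_{τπ₀}`),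
DEF **`quotientEquivOrbit : Γ ⧸ D ≃ Π`, `τD ↦ τπ₀`** (`coe_quotientEquivOrbit_mk`), DEF `groupRingEquivOrbit : R[Γ/D] ≃ₗ R[Π]` («hence an
isomorphism `ℤ[Γ/D] → ℤ[Π]`»), `card_orbit_piGerm_mul_card : |Π|·d = |Γ| (= 2n)`.  §2 (the CM field `K`, `Γ = Gal(K/ℚ)`, `ι` = complex
conjugation, `D = decompositionGroup p 𝔭`, any `Γ₀` with `h : Setting conjGal Γ₀ D` — e.g. g18-#1 `cosetGermSetting` for `K = Q·F`, `p` split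
in `Q`): `toGroupRing_characterRep` and **`germToCosetFun_weilLimitInRep`** (g18-#2's `X^*(S^K) ↪ ℤ[Γ]` and `X^*(P^K) ↪ ℤ[Γ/D]` are
equivariant for `σ′ ↦ σ′|_K = ρ`, i.e. `σ′τ₀ = τ₀ρ`); DEF `piZero` with **`germToCosetFun_piZero : f_{π₀} = ϖ₀`** and
`germToCosetFun_weilLimitInRep_piZero : f_{σ′π₀} = ρϖ₀`; **`weilLimitInRep_piZero_eq_iff : σ′π₀ = π₀ ⟺ σ′|_K ∈ D(w₀)`** (`n ≠ 2`); DEF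
`weilOrbitPiZero = Π ⊂ X^*(P^K)`, `mem_weilOrbitPiZero_iff` (`x ∈ Π ⟺ f_x ∈ Γϖ₀`), DEF **`weilOrbitPiZeroEquiv : Π ≃ Γϖ₀`** and
**`quotientEquivWeilOrbitPiZero : Γ ⧸ D(w₀) ≃ Π`** («`τ ↦ τπ₀` defines a bijection `Γ/D → Π`» for `K`; `quotientEquivWeilOrbitPiZero_mk :
ρD ↦ σ′π₀`), **`card_weilOrbitPiZero_mul_localDegree : |Π|·[K_{w₀} : ℚ_p] = [K : ℚ]`**; §3 the `K = Q·F` instances `…_of_split` /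
`…OfSplit` with the hypothesis spelled `[K : Q] ≠ 2` (`card_filter_mem_fixingSubgroup : n = [K : Q]`).

SCOPE / NOT HERE.  (1) The stabilizer statement needs `n = |Γ₀| ≠ 2`: for `n = 2` (`K` quartic, `F` real quadratic) `ϖ₀ = σ₀ + (d−1)ισ₀ (+ dισ₁)`
is fixed by `ιτ₁` when `d = 1` and by `ι` when `d = 2`, so `|Π| < |Γ/D|` and «`τ ↦ τπ₀` … bijection» fails as printed; the print's standing
hypothesis is only `K ≠ Q` (p. 69 L4), so this boundary case (harmless for Theorem 6.1, whose proof only uses the span of `Π`) is recorded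
here as a hypothesis rather than silently assumed.  (2) `Ψ` («a `Γ`-orbit in `X^*(S^K)`») in the model is g17-#4's orbit of `psiType`; its
number-field reading is g18-#3 `toCMTypes_mem_orbit_iff`/`toGroupRing_cmTypeChar_psiType` — not repeated.  (3) Nothing here is a case of the
Hodge conjecture; Theorem 6.1 itself (level `K`, on characters) is g17-#5/g18-#3, the limit over `K` is not claimed (Layer B, B5-09).

## References
* [Milne1999] J. S. Milne, *Lefschetz motives and the Tate conjecture*, Compositio Math. 117 (1999) 45–76, §6 pp. 69–70.

## Provenance
lit-hodgefound seat p27, generation 18, row g18-#4 (Milne 1999 §6, the orbit `Π` and `Γ/D ≃ Π`, model + number field).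
-/

set_option autoImplicit false

noncomputable section

open scoped NumberField Pointwise

namespace Literature.NumberTheory.ComplexMultiplication

/-! ### §1 In the model: `π_τ = red(τ·psiType)`, `γπ_τ = π_{γτ}`, `Stab_Γ(π₀) = D` (for `n ≠ 2`), `Γ/D ≃ Π` -/

namespace CosetGerm

open Finset OrbitTorus

variable {Γ : Type*} [Group Γ] {ι : Γ} {Γ₀ D : Subgroup Γ}
variable [Fintype Γ] [DecidableEq Γ] [DecidablePred (· ∈ Γ₀)] [DecidablePred (· ∈ D)]
variable (R : Type*) [CommRing R]

omit [DecidableEq Γ] in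
/-- `(Σ_i δ_{ισ_i})(c) = [ιc ∈ {σ_i}]`. [cite: Milne1999, §6 p. 70 L12–L16] -/
theorem sum_single_iota_smul_apply (h : Setting ι Γ₀ D) (c : Γ ⧸ D) :
    (∑ k : ↥(halfCosets Γ₀ D), Finsupp.single (ι • (k : Γ ⧸ D)) (1 : R)) c = if ι • c ∈ halfCosets Γ₀ D then 1 else 0 := by
  rw [Finsupp.finsetSum_apply, Finset.sum_coe_sort (halfCosets Γ₀ D) (fun k => Finsupp.single (ι • k) (1 : R) c)]
  have hiff : ∀ k : Γ ⧸ D, (ι • k = c) = (k = ι • c) := fun k =>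
    propext ⟨fun e => by rw [← e, h.smul_smul_eq], fun e => by rw [e, h.smul_smul_eq]⟩
  simp only [Finsupp.single_apply, hiff, Finset.sum_ite_eq']

omit [DecidableEq Γ] in
/-- `(Σ_i δ_{σ_i})(c) = [c ∈ {σ_i}]`. [cite: Milne1999, §6 p. 70 L12–L16] -/
theorem sum_single_apply (c : Γ ⧸ D) :
    (∑ k : ↥(halfCosets Γ₀ D), Finsupp.single (k : Γ ⧸ D) (1 : R)) c = if c ∈ halfCosets Γ₀ D then 1 else 0 := by
  rw [Finsupp.finsetSum_apply, Finset.sum_coe_sort (halfCosets Γ₀ D) (fun k => Finsupp.single k (1 : R) c)]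
  simp only [Finsupp.single_apply, Finset.sum_ite_eq']

variable (h : Setting ι Γ₀ D)

/-- **`π_τ = π(ψ_τ)` in the model**: the Weil germ `red(τ·psiType) = push(ψ_τ) ∈ R[Γ/D]` of the CM type `Φ_τ = {τ} ∪ {ιτ′ | τ′ ∈ Γ₀, τ′ ≠ τ}`
of `ψ_τ = τψ₀` (Milne's `π_i = π(ψ_{id})`; defined for every `τ ∈ Γ`, so that `π_{ιτ} = ιπ_τ`). [cite: Milne1999, §6 p. 69 L26–L28] -/
def piGerm (τ : Γ) : WeilGerms R h := red R h (τ • psiType h)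

/-- `ϖ_τ = δ_{τD} − δ_{ιτD} + d·Σ_i δ_{ισ_i}` for `τ ∈ Γ₀` (g17-#2 `pushFun_psi`). [cite: Milne1999, §6 p. 70 L12–L16] -/
theorem coe_piGerm {τ : Γ} (hτ : τ ∈ Γ₀) :
    (piGerm R h τ).1 = Finsupp.single (τ : Γ ⧸ D) 1 - Finsupp.single (ι • (τ : Γ ⧸ D)) 1
      + (Fintype.card D : R) • ∑ k : ↥(halfCosets Γ₀ D), Finsupp.single (ι • (k : Γ ⧸ D)) 1 := by
  rw [piGerm, coe_red, ind_smul_psiType R h hτ, pushFun_psi R h hτ]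

/-- `ιϖ_τ = δ_{ιτD} − δ_{τD} + d·Σ_i δ_{σ_i}` for `τ ∈ Γ₀` (g17-#2 `pushFun_act_iota_psi`). [cite: Milne1999, §6 p. 70 L12–L16] -/
theorem coe_iota_smul_piGerm {τ : Γ} (hτ : τ ∈ Γ₀) :
    (ι • piGerm R h τ).1 = Finsupp.single (ι • (τ : Γ ⧸ D)) 1 - Finsupp.single (τ : Γ ⧸ D) 1
      + (Fintype.card D : R) • ∑ k : ↥(halfCosets Γ₀ D), Finsupp.single (k : Γ ⧸ D) 1 := by
  rw [WeilGerms.coe_smul, piGerm, coe_red, ind_smul_psiType R h hτ, ← pushFun_act_iota_psi R h hτ,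
    pushFun_act R ((↑) : Γ → Γ ⧸ D) (g := ι) (fun _ => rfl)]

omit [DecidablePred (· ∈ D)] in
/-- **«As `τ_iψ₀ = ψ_i`, `(ιτ_i)ψ₀ = ιψ_i` …»** pushed to `X^*(P^K)`: `γ·π_τ = π_{γτ}`, so `Π = {π_τ | τ ∈ Γ} = Γπ₀` is the `Γ`-orbit of `π₀`.
[cite: Milne1999, §6 p. 69 L24–L28] -/
theorem smul_piGerm (γ τ : Γ) : γ • piGerm R h τ = piGerm R h (γ * τ) := by
  simp only [piGerm, mul_smul, red_smul]

omit [DecidablePred (· ∈ D)] in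
/-- `Π = Γπ₀` consists of the `π_τ`, `τ ∈ Γ`. [cite: Milne1999, §6 p. 69 L26–L28] -/
theorem mem_orbit_piGerm_one_iff (w : WeilGerms R h) : w ∈ MulAction.orbit Γ (piGerm R h 1) ↔ ∃ τ : Γ, piGerm R h τ = w := by
  constructor
  · rintro ⟨τ, rfl⟩
    refine ⟨τ, ?_⟩
    simp only [smul_piGerm, mul_one]
  · rintro ⟨τ, rfl⟩
    refine ⟨τ, ?_⟩
    simp only [smul_piGerm, mul_one]

/-- The value of `ϖ_τ` at a `Γ₀`-coset `τ₁D`: `[τD = τ₁D]`. [cite: Milne1999, §6 p. 70 L12–L16] -/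
theorem coe_piGerm_apply_coe {τ τ₁ : Γ} (hτ : τ ∈ Γ₀) (hτ₁ : τ₁ ∈ Γ₀) :
    (piGerm R h τ).1 (τ₁ : Γ ⧸ D) = if (τ : Γ ⧸ D) = (τ₁ : Γ ⧸ D) then 1 else 0 := by
  rw [coe_piGerm R h hτ, Finsupp.add_apply, Finsupp.sub_apply, Finsupp.smul_apply, sum_single_iota_smul_apply R h,
    if_neg (smul_not_mem_halfCosets h (coe_mem_halfCosets hτ₁)), smul_zero, add_zero, Finsupp.single_apply, Finsupp.single_apply,
    if_neg (h.smul_coe_ne_coe hτ₁ hτ), sub_zero]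

/-- The value of `ϖ_τ` at `ιτ₁D`: `d − [τD = τ₁D]`. [cite: Milne1999, §6 p. 70 L12–L16] -/
theorem coe_piGerm_apply_iota_smul_coe {τ τ₁ : Γ} (hτ : τ ∈ Γ₀) (hτ₁ : τ₁ ∈ Γ₀) :
    (piGerm R h τ).1 (ι • (τ₁ : Γ ⧸ D)) = (Fintype.card D : R) - if (τ : Γ ⧸ D) = (τ₁ : Γ ⧸ D) then 1 else 0 := by
  have hs : Finsupp.single (ι • (τ : Γ ⧸ D)) (1 : R) (ι • (τ₁ : Γ ⧸ D)) = Finsupp.single (τ : Γ ⧸ D) (1 : R) (τ₁ : Γ ⧸ D) :=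
    Finsupp.single_apply_left (MulAction.injective ι) _ _ _
  rw [coe_piGerm R h hτ, Finsupp.add_apply, Finsupp.sub_apply, Finsupp.smul_apply, sum_single_iota_smul_apply R h, h.smul_smul_eq,
    if_pos (coe_mem_halfCosets hτ₁), smul_eq_mul, mul_one, hs, Finsupp.single_apply, Finsupp.single_apply,
    if_neg (h.smul_coe_ne_coe hτ hτ₁).symm]
  ring

/-- The value of `ιϖ_τ` at `τ₁D`: `d − [τD = τ₁D]`. [cite: Milne1999, §6 p. 70 L12–L16] -/
theorem coe_iota_smul_piGerm_apply_coe {τ τ₁ : Γ} (hτ : τ ∈ Γ₀) (hτ₁ : τ₁ ∈ Γ₀) :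
    (ι • piGerm R h τ).1 (τ₁ : Γ ⧸ D) = (Fintype.card D : R) - if (τ : Γ ⧸ D) = (τ₁ : Γ ⧸ D) then 1 else 0 := by
  rw [coe_iota_smul_piGerm R h hτ, Finsupp.add_apply, Finsupp.sub_apply, Finsupp.smul_apply, sum_single_apply R,
    if_pos (coe_mem_halfCosets hτ₁), smul_eq_mul, mul_one, Finsupp.single_apply, Finsupp.single_apply,
    if_neg (h.smul_coe_ne_coe hτ₁ hτ)]
  ring

/-- The value of `ιϖ_τ` at `ιτ₁D`: `[τD = τ₁D]`. [cite: Milne1999, §6 p. 70 L12–L16] -/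
theorem coe_iota_smul_piGerm_apply_iota_smul_coe {τ τ₁ : Γ} (hτ : τ ∈ Γ₀) (hτ₁ : τ₁ ∈ Γ₀) :
    (ι • piGerm R h τ).1 (ι • (τ₁ : Γ ⧸ D)) = if (τ : Γ ⧸ D) = (τ₁ : Γ ⧸ D) then 1 else 0 := by
  have hs : Finsupp.single (ι • (τ : Γ ⧸ D)) (1 : R) (ι • (τ₁ : Γ ⧸ D)) = Finsupp.single (τ : Γ ⧸ D) (1 : R) (τ₁ : Γ ⧸ D) :=
    Finsupp.single_apply_left (MulAction.injective ι) _ _ _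
  rw [coe_iota_smul_piGerm R h hτ, Finsupp.add_apply, Finsupp.sub_apply, Finsupp.smul_apply, sum_single_apply R,
    if_neg (smul_not_mem_halfCosets h (coe_mem_halfCosets hτ₁)), smul_zero, add_zero, hs, Finsupp.single_apply, Finsupp.single_apply,
    if_neg (h.smul_coe_ne_coe hτ hτ₁).symm, sub_zero]

/-- `π_τ` depends only on `τD` (`τ, τ′ ∈ Γ₀`): `τD ↦ τπ₀ = π_τ` is well defined. [cite: Milne1999, §6 p. 70 L7–L8] -/
theorem piGerm_eq_of_coe_eq {τ τ' : Γ} (hτ : τ ∈ Γ₀) (hτ' : τ' ∈ Γ₀) (e : (τ : Γ ⧸ D) = (τ' : Γ ⧸ D)) :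
    piGerm R h τ = piGerm R h τ' :=
  WeilGerms.ext R h (by rw [coe_piGerm R h hτ, coe_piGerm R h hτ', e])

/-- **`π_τ = π_{τ′} ⟺ τD = τ′D`** for `τ, τ′ ∈ Γ₀` (`R` nontrivial; compare the coefficients of `δ_{τD}`). [cite: Milne1999, §6 p. 70 L7–L8] -/
theorem piGerm_eq_piGerm_iff [Nontrivial R] {τ τ' : Γ} (hτ : τ ∈ Γ₀) (hτ' : τ' ∈ Γ₀) :
    piGerm R h τ = piGerm R h τ' ↔ (τ : Γ ⧸ D) = (τ' : Γ ⧸ D) := by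
  refine ⟨fun e => ?_, piGerm_eq_of_coe_eq R h hτ hτ'⟩
  have e' : (piGerm R h τ).1 (τ : Γ ⧸ D) = (piGerm R h τ').1 (τ : Γ ⧸ D) := by rw [e]
  rw [coe_piGerm_apply_coe R h hτ hτ, coe_piGerm_apply_coe R h hτ' hτ, if_pos rfl] at e'
  by_contra hne
  rw [if_neg (Ne.symm hne)] at e'
  exact one_ne_zero e'

/-- `δ ∈ D` fixes `π₀`: `δπ₀ = π_δ = π₀` (`δD = D`). [cite: Milne1999, §6 p. 70 L7–L8] -/
theorem smul_piGerm_one_of_mem {δ : Γ} (hδ : δ ∈ D) : δ • piGerm R h 1 = piGerm R h 1 := by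
  rw [smul_piGerm, mul_one]
  exact piGerm_eq_of_coe_eq R h (h.le hδ) Γ₀.one_mem (by rw [QuotientGroup.eq, mul_one]; exact D.inv_mem hδ)

/-- **THE STABILIZER OF `π₀` IN `Γ` IS `D`: `γπ₀ = π₀ ⟺ γ ∈ D`** («the map `τ ↦ τπ₀` defines a bijection `Γ/D → Π`»), for `R` of characteristic
`0` and `n = |Γ₀| ≠ 2`.  For `γ ∈ Γ₀`, `γπ₀ = π_γ = π₀ ⟺ γD = D`; for `γ = ιγ₀`, `γ₀ ∈ Γ₀`, `γπ₀ = ιπ_{γ₀}` has value `d − [γ₀D = D]` at `D`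
and `d` at every `σ_i ∉ {D, γ₀D}`, while `π₀` has values `1` and `0` there — impossible unless `{σ_i} ⊆ {D, γ₀D}` with `d = 2`
(`γ₀D = D`) or `d = 1` (`γ₀D ≠ D`), i.e. `n = |{σ_i}|·d = 2`.  SCOPE: for `n = 2` the stabilizer IS larger (`{1, ιγ₀}·D` resp. `Γ`).
[cite: Milne1999, §6 p. 70 L7–L8, p. 69 L26–L28] -/
theorem smul_piGerm_one_eq_iff [CharZero R] (hn : (univ.filter (· ∈ Γ₀) : Finset Γ).card ≠ 2) (γ : Γ) :
    γ • piGerm R h 1 = piGerm R h 1 ↔ γ ∈ D := by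
  haveI : Nontrivial R := nontrivial_of_ne 0 1 zero_ne_one
  refine ⟨fun e => ?_, smul_piGerm_one_of_mem R h⟩
  have hd0 : 0 < Fintype.card D := Fintype.card_pos
  rcases h.mem_or_mem γ with hγ | hγ
  · -- `γ ∈ Γ₀`: `π_γ = π₀` forces `γD = D`
    rw [smul_piGerm, mul_one, piGerm_eq_piGerm_iff R h hγ Γ₀.one_mem, QuotientGroup.eq, mul_one] at e
    exact D.inv_mem_iff.1 e
  · -- `γ = ιγ₀` with `γ₀ = ιγ ∈ Γ₀`
    exfalso
    set γ₀ : Γ := ι * γ with hγ₀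
    have eγ : γ • piGerm R h 1 = ι • piGerm R h γ₀ := by
      rw [smul_piGerm, smul_piGerm, mul_one, hγ₀, ← mul_assoc, h.mul_self, one_mul]
    rw [eγ] at e
    -- the value at `D`
    have hD : (ι • piGerm R h γ₀).1 ((1 : Γ) : Γ ⧸ D) = (piGerm R h 1).1 ((1 : Γ) : Γ ⧸ D) := by rw [e]
    rw [coe_iota_smul_piGerm_apply_coe R h hγ Γ₀.one_mem, coe_piGerm_apply_coe R h Γ₀.one_mem Γ₀.one_mem, if_pos rfl] at hD
    -- no third `Γ₀`-coset
    have hthird : ∀ τ ∈ Γ₀, (τ : Γ ⧸ D) = ((1 : Γ) : Γ ⧸ D) ∨ (τ : Γ ⧸ D) = (γ₀ : Γ ⧸ D) := by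
      intro τ hτ
      by_contra hno
      push Not at hno
      have hv : (ι • piGerm R h γ₀).1 (τ : Γ ⧸ D) = (piGerm R h 1).1 (τ : Γ ⧸ D) := by rw [e]
      rw [coe_iota_smul_piGerm_apply_coe R h hγ hτ, coe_piGerm_apply_coe R h Γ₀.one_mem hτ, if_neg (Ne.symm hno.2),
        if_neg (Ne.symm hno.1), sub_zero] at hv
      exact hd0.ne' (by exact_mod_cast hv)
    have hsub : halfCosets Γ₀ D ⊆ {((1 : Γ) : Γ ⧸ D), (γ₀ : Γ ⧸ D)} := by
      intro c hc
      obtain ⟨τ, hτ, rfl⟩ := exists_rep_of_mem_halfCosets hc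
      rcases hthird τ hτ with h1 | h2
      · exact Finset.mem_insert.2 (Or.inl h1)
      · exact Finset.mem_insert.2 (Or.inr (Finset.mem_singleton.2 h2))
    have hn' : (univ.filter (· ∈ Γ₀) : Finset Γ).card = (halfCosets Γ₀ D).card * Fintype.card D :=
      (card_halfCosets_mul_card h.le).symm
    by_cases h10 : (γ₀ : Γ ⧸ D) = ((1 : Γ) : Γ ⧸ D)
    · -- `γ₀ ∈ D`: `d = 2`, `{σ_i} = {D}`, `n = 2`
      rw [if_pos h10] at hD
      have hd2 : Fintype.card D = 2 := by
        have : (Fintype.card D : R) = 2 := by linear_combination hD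
        exact_mod_cast this
      have hhalf : halfCosets Γ₀ D = {((1 : Γ) : Γ ⧸ D)} := by
        refine Finset.Subset.antisymm ?_ (Finset.singleton_subset_iff.2 (coe_mem_halfCosets Γ₀.one_mem))
        rw [h10, Finset.pair_eq_singleton] at hsub
        exact hsub
      rw [hhalf, Finset.card_singleton, hd2, one_mul] at hn'
      exact hn hn'
    · -- `γ₀ ∉ D`: `d = 1`, `{σ_i} = {D, γ₀D}`, `n = 2`
      rw [if_neg h10, sub_zero] at hD
      have hd1 : Fintype.card D = 1 := by exact_mod_cast hD
      have hhalf : halfCosets Γ₀ D = {((1 : Γ) : Γ ⧸ D), (γ₀ : Γ ⧸ D)} :=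
        Finset.Subset.antisymm hsub (Finset.insert_subset_iff.2
          ⟨coe_mem_halfCosets Γ₀.one_mem, Finset.singleton_subset_iff.2 (coe_mem_halfCosets hγ)⟩)
      rw [hhalf, Finset.card_pair (Ne.symm h10), hd1, mul_one] at hn'
      exact hn hn'

/-- **`Stab_Γ(π₀) = D`** (`n ≠ 2`, characteristic `0`). [cite: Milne1999, §6 p. 70 L7–L8] -/
theorem stabilizer_piGerm_one [CharZero R] (hn : (univ.filter (· ∈ Γ₀) : Finset Γ).card ≠ 2) :
    MulAction.stabilizer Γ (piGerm R h 1) = D :=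
  Subgroup.ext fun γ => by rw [MulAction.mem_stabilizer_iff, smul_piGerm_one_eq_iff R h hn]

/-- `τD ↦ τπ₀ : Γ/D → Π` (well defined because `D` fixes `π₀`). [cite: Milne1999, §6 p. 70 L7–L8] -/
def quotientToOrbit : Γ ⧸ D → MulAction.orbit Γ (piGerm R h 1) :=
  Quotient.lift (fun τ : Γ => (⟨τ • piGerm R h 1, MulAction.mem_orbit _ τ⟩ : MulAction.orbit Γ (piGerm R h 1))) (by
    intro a b hab
    apply Subtype.ext
    change a • piGerm R h 1 = b • piGerm R h 1
    have hb : b = a * (a⁻¹ * b) := by rw [mul_inv_cancel_left]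
    rw [hb, mul_smul, smul_piGerm_one_of_mem R h (QuotientGroup.leftRel_apply.mp hab)])

/-- [cite: Milne1999, §6 p. 70 L7–L8] -/
@[simp] theorem coe_quotientToOrbit_mk (τ : Γ) : (quotientToOrbit R h (τ : Γ ⧸ D) : WeilGerms R h) = τ • piGerm R h 1 := rfl

/-- **g17-#3's `germ` IS `τD ↦ f_{τπ₀}`**: the function `germ : Γ/D → R[Γ/D]` through which g17-#3 defined `X^*(β) : X^*(L^Π) → X^*(P^K)`
on the basis «`Π ≅ Γ/D`» (`betaPi_mk_single : X^*(β)[δ_{τD}] = push(τψ₀)`) is `τD ↦ (τπ₀).1 = ϖ_τ` — so g17-#3's reading `X^*(L^Π) =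
CharModule R (Γ ⧸ D) ι` is the transport along `quotientEquivOrbit` below. [cite: Milne1999, §6 p. 70 L7–L12] -/
theorem germ_eq_coe_piGerm (τ : Γ) : germ R h (τ : Γ ⧸ D) = (piGerm R h τ).1 := by
  rw [germ_coe, piGerm, coe_red, ← act_ind, ind_psiType]

/-- `germ c = (quotientToOrbit c).1`: g17-#3's `germ` factors through `Π`. [cite: Milne1999, §6 p. 70 L7–L12] -/
theorem germ_eq_coe_quotientToOrbit (c : Γ ⧸ D) :
    germ R h c = ((quotientToOrbit R h c : MulAction.orbit Γ (piGerm R h 1)) : WeilGerms R h).1 := by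
  induction c using QuotientGroup.induction_on with | H τ => ?_
  rw [germ_eq_coe_piGerm, coe_quotientToOrbit_mk, smul_piGerm, mul_one]

/-- `τD ↦ τπ₀` is onto `Π`. [cite: Milne1999, §6 p. 70 L7–L8] -/
theorem quotientToOrbit_surjective : Function.Surjective (quotientToOrbit R h) := by
  rintro ⟨w, τ, rfl⟩
  exact ⟨(τ : Γ ⧸ D), rfl⟩

/-- `τD ↦ τπ₀` is injective for `n ≠ 2` (characteristic `0`). [cite: Milne1999, §6 p. 70 L7–L8] -/
theorem quotientToOrbit_injective [CharZero R] (hn : (univ.filter (· ∈ Γ₀) : Finset Γ).card ≠ 2) :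
    Function.Injective (quotientToOrbit R h) := by
  intro a b e
  obtain ⟨a, rfl⟩ := QuotientGroup.mk_surjective a
  obtain ⟨b, rfl⟩ := QuotientGroup.mk_surjective b
  have e' : a • piGerm R h 1 = b • piGerm R h 1 :=
    congrArg (fun x : MulAction.orbit Γ (piGerm R h 1) => (x : WeilGerms R h)) e
  rw [QuotientGroup.eq, ← smul_piGerm_one_eq_iff R h hn, mul_smul, ← e', inv_smul_smul]

/-- **«The map `τ ↦ τπ₀` defines a bijection `Γ/D → Π`»** (in the model; `n = |Γ₀| ≠ 2`, `R` of characteristic `0`).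
[cite: Milne1999, §6 p. 70 L7–L8] -/
def quotientEquivOrbit [CharZero R] (hn : (univ.filter (· ∈ Γ₀) : Finset Γ).card ≠ 2) : Γ ⧸ D ≃ MulAction.orbit Γ (piGerm R h 1) :=
  Equiv.ofBijective (quotientToOrbit R h) ⟨quotientToOrbit_injective R h hn, quotientToOrbit_surjective R h⟩

/-- [cite: Milne1999, §6 p. 70 L7–L8] -/
@[simp] theorem coe_quotientEquivOrbit_mk [CharZero R] (hn : (univ.filter (· ∈ Γ₀) : Finset Γ).card ≠ 2) (τ : Γ) :
    (quotientEquivOrbit R h hn (τ : Γ ⧸ D) : WeilGerms R h) = τ • piGerm R h 1 := rfl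

/-- **«… and hence an isomorphism `ℤ[Γ/D] → ℤ[Π]`»**: `R[Γ/D] ≅ R[Π]` along `τD ↦ τπ₀`. [cite: Milne1999, §6 p. 70 L7–L8] -/
def groupRingEquivOrbit [CharZero R] (hn : (univ.filter (· ∈ Γ₀) : Finset Γ).card ≠ 2) :
    (Γ ⧸ D →₀ R) ≃ₗ[R] (MulAction.orbit Γ (piGerm R h 1) →₀ R) :=
  Finsupp.domLCongr (quotientEquivOrbit R h hn)

/-- [cite: Milne1999, §6 p. 70 L7–L8] -/
@[simp] theorem groupRingEquivOrbit_single [CharZero R] (hn : (univ.filter (· ∈ Γ₀) : Finset Γ).card ≠ 2) (τ : Γ) (r : R) :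
    groupRingEquivOrbit R h hn (Finsupp.single (τ : Γ ⧸ D) r) = Finsupp.single (quotientEquivOrbit R h hn (τ : Γ ⧸ D)) r := by
  rw [groupRingEquivOrbit, Finsupp.domLCongr_single]

/-- **`|Π|·d = |Γ| = 2n`**: «`Π = {π₀, …, π_{(n/d)−1}, ιπ₀, …, ιπ_{(n/d)−1}}`» has `2n/d` elements (`n ≠ 2`). [cite: Milne1999, §6 p. 69 L26–L28] -/
theorem card_orbit_piGerm_mul_card [CharZero R] (hn : (univ.filter (· ∈ Γ₀) : Finset Γ).card ≠ 2) :
    Nat.card (MulAction.orbit Γ (piGerm R h 1)) * Nat.card D = Nat.card Γ := by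
  rw [← Nat.card_congr (quotientEquivOrbit R h hn), ← Subgroup.card_eq_card_quotient_mul_card_subgroup D]

end CosetGerm

/-! ### §2 For the CM field `K`: `π₀ = π(ψ₀) ∈ X^*(P^K)`, its `Gal(ℚ^{cm}/ℚ)`-orbit `Π`, «`σ′π₀ = π₀ ⟺ σ′|_K ∈ D(w₀)`», `Γ/D(w₀) ≃ Π` -/

namespace CMNumbers

open _root_.NumberField IntermediateField Finset
open Literature.NumberTheory.NumberFields (cmNumbers cmNumbersConj)
open OrbitTorus (pushFun act)
open CosetGerm (Setting WeilGerms piGerm)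
open SerreGroupTorus (infinityTypesRep coe_infinityTypesRep_apply)

section GroupRing

variable {K : Type} [Field K] [NumberField K] (τ₀ : K →ₐ[ℚ] cmNumbers)

/-- **`X^*(S^K) ↪ ℤ[Γ]` is equivariant**: if `σ′ ∘ τ₀ = τ₀ ∘ ρ` (`σ′ ∈ Gal(ℚ^{cm}/ℚ)` restricts to `ρ ∈ Γ` in the coordinate `τ₀`), then
`Σ_σ (σ′g)(τ₀σ)σ = ρ·Σ_σ g(τ₀σ)σ` (g18-#2 `toGroupRing`, skel-3 `characterRep`, g17 `act`). [cite: Milne1999, §6 p. 69 L18–L19, §5 p. 63 L8–L9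
(«It commutes with the action of Γ»)] -/
theorem toGroupRing_characterRep (σ' : cmNumbers ≃ₐ[ℚ] cmNumbers) (ρ : K ≃ₐ[ℚ] K) (hρ : σ' • τ₀ = embOfAut τ₀ ρ)
    (g : (K →ₐ[ℚ] cmNumbers) → ℤ) :
    toGroupRing τ₀ (characterRep (cmNumbers ≃ₐ[ℚ] cmNumbers) (K →ₐ[ℚ] cmNumbers) σ' g) = act ℤ ρ (toGroupRing τ₀ g) := by
  have key : ∀ δ : K ≃ₐ[ℚ] K, σ' • embOfAut τ₀ δ = embOfAut τ₀ (ρ * δ) := fun δ => by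
    rw [embOfAut_mul, ← hρ]; rfl
  ext δ
  have e1 : σ'⁻¹ • embOfAut τ₀ δ = embOfAut τ₀ (ρ⁻¹ * δ) := by rw [inv_smul_eq_iff, key, mul_inv_cancel_left]
  rw [toGroupRing_apply, characterRep_apply, e1, CosetGerm.act_apply, toGroupRing_apply]

end GroupRing

section Germs

variable {K : Type} [Field K] [NumberField K] [IsCMField K] [IsGalois ℚ K]
variable (p : ℕ) [hp : Fact p.Prime] (𝔭 : Ideal (𝓞 K)) [h𝔭P : 𝔭.IsPrime] [h𝔭 : 𝔭.LiesOver (Ideal.span {(p : ℤ)})]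
variable (τ₀ : K →ₐ[ℚ] cmNumbers)

/-- **`X^*(P^K) ↪ ℤ[Γ/D]`, `π ↦ f_π`, IS EQUIVARIANT**: `f_{σ′π} = ρ·f_π` when `σ′ ∘ τ₀ = τ₀ ∘ ρ` (through Lemma 5.1's diagram, g18-#2
`pushFun_toGroupRing`, and `X^*(α^K)` equivariant, g16 `alphaCharIn_infinityTypesRep`). [cite: Milne1999, §6 p. 69 L18–L21, p. 70 L11 («The
map at right sends π to the map σ ↦ f_π(σw₀)»), §5 p. 63 L8–L9] -/
theorem germToCosetFun_weilLimitInRep (σ' : cmNumbers ≃ₐ[ℚ] cmNumbers) (ρ : K ≃ₐ[ℚ] K) (hρ : σ' • τ₀ = embOfAut τ₀ ρ)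
    (x : Additive (weilLimitIn K p τ₀)) :
    germToCosetFun p 𝔭 τ₀ (weilLimitInRep p τ₀ σ' x) = act ℤ ρ (germToCosetFun p 𝔭 τ₀ x) := by
  obtain ⟨g, rfl⟩ := alphaCharIn_surjective p 𝔭 τ₀ x
  rw [← alphaCharIn_infinityTypesRep, ← pushFun_toGroupRing, ← pushFun_toGroupRing, coe_infinityTypesRep_apply,
    toGroupRing_characterRep τ₀ σ' ρ hρ,
    OrbitTorus.pushFun_act ℤ ((↑) : (K ≃ₐ[ℚ] K) → (K ≃ₐ[ℚ] K) ⧸ decompositionGroup p 𝔭) (g := ρ) (fun _ => rfl)]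

variable {Γ₀ : Subgroup (K ≃ₐ[ℚ] K)} (h : Setting (conjGal : K ≃ₐ[ℚ] K) Γ₀ (decompositionGroup p 𝔭))
variable [DecidableEq (K ≃ₐ[ℚ] K)] [DecidablePred (· ∈ Γ₀)]

/-- **`π₀ = π(ψ₀) ∈ W^K_{1,+}(p^∞) ⊂ X^*(P^K)`**: the image under `X^*(α^K)` of the character `ψ₀ = λ_{Φ₀}` of the CM type
`Φ₀ = {τ₀} ∪ {τ₀ιτ | τ ∈ Γ₀, τ ≠ 1}` of `K` (g18-#3 `ofCMTypes τ₀ h (psiType h)`, `toGroupRing_cmTypeChar_psiType : λ_{Φ₀} ↦ ψ₀ = ψ_1`).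
[cite: Milne1999, §6 p. 69 L26–L27 («Let π_i = π(ψ_{id}) ∈ W^K_{1,+}(p^∞)»)] -/
def piZero : Additive (weilLimitIn K p τ₀) :=
  alphaCharIn p 𝔭 τ₀ (cmTypeChar (isCMTypeWith_ofCMTypes τ₀ h (CosetGerm.psiType h)))

/-- **`f_{π₀} = ϖ₀`**: under `X^*(P^K) ↪ ℤ[Γ/D]` the number-theoretic `π₀` is the model's `π₀ = piGerm ℤ h 1` (g18-#3 `coe_red_toCMTypes`).
[cite: Milne1999, §6 p. 69 L26–L28, p. 70 L11–L16] -/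
theorem germToCosetFun_piZero : germToCosetFun p 𝔭 τ₀ (piZero p 𝔭 τ₀ h) = (piGerm ℤ h 1).1 := by
  rw [piZero, ← coe_red_toCMTypes p 𝔭 τ₀ h, toCMTypes_ofCMTypes, CosetGerm.piGerm, one_smul]

/-- `f_{σ′π₀} = ρ·ϖ₀ = ϖ_ρ` for `σ′ ∘ τ₀ = τ₀ ∘ ρ`. [cite: Milne1999, §6 p. 69 L26–L28, p. 70 L7–L8] -/
theorem germToCosetFun_weilLimitInRep_piZero (σ' : cmNumbers ≃ₐ[ℚ] cmNumbers) (ρ : K ≃ₐ[ℚ] K) (hρ : σ' • τ₀ = embOfAut τ₀ ρ) :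
    germToCosetFun p 𝔭 τ₀ (weilLimitInRep p τ₀ σ' (piZero p 𝔭 τ₀ h)) = (ρ • piGerm ℤ h 1).1 := by
  rw [germToCosetFun_weilLimitInRep p 𝔭 τ₀ σ' ρ hρ, germToCosetFun_piZero, CosetGerm.WeilGerms.coe_smul]

variable [DecidablePred (· ∈ decompositionGroup p 𝔭)]

/-- **«`σ′π₀ = π₀ ⟺ σ′|_K ∈ D(w₀)`»: the stabilizer of `π₀ ∈ X^*(P^K)` in `Gal(ℚ^{cm}/ℚ)` is the preimage of the decomposition group** —
the content of «the map `τ ↦ τπ₀` defines a bijection `Γ/D → Π`» — for `n = |Γ₀| ≠ 2` (§1 `smul_piGerm_one_eq_iff` transported along the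
injection `π ↦ f_π`). [cite: Milne1999, §6 p. 70 L7–L8, L11] -/
theorem weilLimitInRep_piZero_eq_iff (hn : (univ.filter (· ∈ Γ₀) : Finset (K ≃ₐ[ℚ] K)).card ≠ 2)
    (σ' : cmNumbers ≃ₐ[ℚ] cmNumbers) (ρ : K ≃ₐ[ℚ] K) (hρ : σ' • τ₀ = embOfAut τ₀ ρ) :
    weilLimitInRep p τ₀ σ' (piZero p 𝔭 τ₀ h) = piZero p 𝔭 τ₀ h ↔ ρ ∈ decompositionGroup p 𝔭 := by
  rw [← (germToCosetFun_injective p 𝔭 τ₀).eq_iff, germToCosetFun_weilLimitInRep_piZero p 𝔭 τ₀ h σ' ρ hρ, germToCosetFun_piZero,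
    ← CosetGerm.smul_piGerm_one_eq_iff ℤ h hn ρ]
  exact ⟨fun e => CosetGerm.WeilGerms.ext ℤ h e, fun e => congrArg Subtype.val e⟩

/-- **`Π ⊂ X^*(P^K)`, the `Gal(ℚ^{cm}/ℚ)`-orbit of `π₀`** («`Π = {π₀, …, ιπ_{(n/d)−1}}` is a `Γ`-orbit in `X^*(P^K)`»).
[cite: Milne1999, §6 p. 69 L26–L28] -/
def weilOrbitPiZero : Set (Additive (weilLimitIn K p τ₀)) :=
  Set.range fun σ' : cmNumbers ≃ₐ[ℚ] cmNumbers => weilLimitInRep p τ₀ σ' (piZero p 𝔭 τ₀ h)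

omit [DecidablePred (· ∈ decompositionGroup p 𝔭)] in
/-- [cite: Milne1999, §6 p. 69 L26–L28] -/
theorem mem_weilOrbitPiZero_iff' (x : Additive (weilLimitIn K p τ₀)) :
    x ∈ weilOrbitPiZero p 𝔭 τ₀ h ↔ ∃ σ' : cmNumbers ≃ₐ[ℚ] cmNumbers, weilLimitInRep p τ₀ σ' (piZero p 𝔭 τ₀ h) = x := Iff.rfl

omit [DecidablePred (· ∈ decompositionGroup p 𝔭)] in
/-- `π₀ ∈ Π`. [cite: Milne1999, §6 p. 69 L26–L28] -/
theorem piZero_mem_weilOrbitPiZero : piZero p 𝔭 τ₀ h ∈ weilOrbitPiZero p 𝔭 τ₀ h :=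
  ⟨1, by simp only [map_one, Module.End.one_apply]⟩

omit [DecidablePred (· ∈ decompositionGroup p 𝔭)] in
/-- **`Π` read in `ℤ[Γ/D]` is the model's orbit `Γϖ₀`**: `x ∈ Π ⟺ f_x ∈ Γ·ϖ₀` (every `ρ ∈ Γ` is a restriction `σ′|_K`, `ℚ^{cm}/ℚ` being normal).
[cite: Milne1999, §6 p. 69 L26–L28, p. 70 L7–L11] -/
theorem mem_weilOrbitPiZero_iff (x : Additive (weilLimitIn K p τ₀)) :
    x ∈ weilOrbitPiZero p 𝔭 τ₀ h ↔ ∃ w ∈ MulAction.orbit (K ≃ₐ[ℚ] K) (piGerm ℤ h 1), germToCosetFun p 𝔭 τ₀ x = w.1 := by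
  constructor
  · rintro ⟨σ', rfl⟩
    obtain ⟨ρ, hρ⟩ := exists_smul_eq_embOfAut τ₀ σ'
    exact ⟨ρ • piGerm ℤ h 1, MulAction.mem_orbit _ ρ, germToCosetFun_weilLimitInRep_piZero p 𝔭 τ₀ h σ' ρ hρ⟩
  · rintro ⟨w, ⟨ρ, rfl⟩, hw⟩
    obtain ⟨σ', hσ'⟩ := exists_smul_eq_embOfAut' τ₀ ρ
    refine ⟨σ', germToCosetFun_injective p 𝔭 τ₀ ?_⟩
    rw [germToCosetFun_weilLimitInRep_piZero p 𝔭 τ₀ h σ' ρ hσ', hw]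

omit [DecidablePred (· ∈ decompositionGroup p 𝔭)] in
/-- `f_x ∈ Γϖ₀` for `x ∈ Π`, as an element of the model orbit. [cite: Milne1999, §6 p. 69 L26–L28] -/
theorem germToCosetFun_mem_orbit (x : weilOrbitPiZero p 𝔭 τ₀ h) :
    ∃ w : MulAction.orbit (K ≃ₐ[ℚ] K) (piGerm ℤ h 1), germToCosetFun p 𝔭 τ₀ x.1 = w.1.1 := by
  obtain ⟨w, hw, e⟩ := (mem_weilOrbitPiZero_iff p 𝔭 τ₀ h x.1).1 x.2
  exact ⟨⟨w, hw⟩, e⟩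

omit [DecidablePred (· ∈ decompositionGroup p 𝔭)] in
/-- **`Π ≃ Γϖ₀`**: `π ↦ f_π` restricts to a bijection of the orbit `Π ⊂ X^*(P^K)` onto the model's orbit of `ϖ₀` in `ℤ[Γ/D]` (injective by
«it is injective (Section 4)», onto by `mem_weilOrbitPiZero_iff`). [cite: Milne1999, §6 p. 69 L26–L28, p. 70 L7–L11] -/
def weilOrbitPiZeroEquiv : weilOrbitPiZero p 𝔭 τ₀ h ≃ MulAction.orbit (K ≃ₐ[ℚ] K) (piGerm ℤ h 1) :=
  Equiv.ofBijective (fun x => (germToCosetFun_mem_orbit p 𝔭 τ₀ h x).choose) ⟨fun x y e => by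
      apply Subtype.ext
      apply germToCosetFun_injective p 𝔭 τ₀
      rw [(germToCosetFun_mem_orbit p 𝔭 τ₀ h x).choose_spec, (germToCosetFun_mem_orbit p 𝔭 τ₀ h y).choose_spec]
      exact congrArg (fun w : MulAction.orbit (K ≃ₐ[ℚ] K) (piGerm ℤ h 1) => w.1.1) e,
    fun w => by
      obtain ⟨x, hx, e⟩ : ∃ x ∈ weilOrbitPiZero p 𝔭 τ₀ h, germToCosetFun p 𝔭 τ₀ x = w.1.1 := by
        obtain ⟨w, ρ, rfl⟩ := w
        obtain ⟨σ', hσ'⟩ := exists_smul_eq_embOfAut' τ₀ ρ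
        exact ⟨_, ⟨σ', rfl⟩, germToCosetFun_weilLimitInRep_piZero p 𝔭 τ₀ h σ' ρ hσ'⟩
      refine ⟨⟨x, hx⟩, Subtype.ext (CosetGerm.WeilGerms.ext ℤ h ?_)⟩
      rw [← (germToCosetFun_mem_orbit p 𝔭 τ₀ h ⟨x, hx⟩).choose_spec, e]⟩

omit [DecidablePred (· ∈ decompositionGroup p 𝔭)] in
/-- [cite: Milne1999, §6 p. 69 L26–L28, p. 70 L7–L11] -/
theorem coe_weilOrbitPiZeroEquiv (x : weilOrbitPiZero p 𝔭 τ₀ h) :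
    ((weilOrbitPiZeroEquiv p 𝔭 τ₀ h x : MulAction.orbit (K ≃ₐ[ℚ] K) (piGerm ℤ h 1)) : WeilGerms ℤ h).1 = germToCosetFun p 𝔭 τ₀ x.1 :=
  (germToCosetFun_mem_orbit p 𝔭 τ₀ h x).choose_spec.symm

/-- **«THE MAP `τ ↦ τπ₀` DEFINES A BIJECTION `Γ/D → Π`» FOR THE CM FIELD `K`**: `Gal(K/ℚ)/D(w₀) ≃ Π ⊂ X^*(P^K)`, `ρD ↦ σ′π₀` for any
`σ′ ∈ Gal(ℚ^{cm}/ℚ)` restricting to `ρ` (`n = |Γ₀| ≠ 2`). [cite: Milne1999, §6 p. 70 L7–L8] -/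
def quotientEquivWeilOrbitPiZero (hn : (univ.filter (· ∈ Γ₀) : Finset (K ≃ₐ[ℚ] K)).card ≠ 2) :
    (K ≃ₐ[ℚ] K) ⧸ decompositionGroup p 𝔭 ≃ weilOrbitPiZero p 𝔭 τ₀ h :=
  (CosetGerm.quotientEquivOrbit ℤ h hn).trans (weilOrbitPiZeroEquiv p 𝔭 τ₀ h).symm

/-- `ρD ↦ σ′π₀` (`σ′ ∘ τ₀ = τ₀ ∘ ρ`), read in `ℤ[Γ/D]`: `f_{(Γ/D ≃ Π)(ρD)} = ρϖ₀ = f_{σ′π₀}`. [cite: Milne1999, §6 p. 70 L7–L8] -/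
theorem germToCosetFun_quotientEquivWeilOrbitPiZero_mk (hn : (univ.filter (· ∈ Γ₀) : Finset (K ≃ₐ[ℚ] K)).card ≠ 2) (ρ : K ≃ₐ[ℚ] K) :
    germToCosetFun p 𝔭 τ₀ (quotientEquivWeilOrbitPiZero p 𝔭 τ₀ h hn (ρ : (K ≃ₐ[ℚ] K) ⧸ decompositionGroup p 𝔭)).1 =
      (ρ • piGerm ℤ h 1).1 := by
  rw [quotientEquivWeilOrbitPiZero, Equiv.trans_apply, ← coe_weilOrbitPiZeroEquiv p 𝔭 τ₀ h, Equiv.apply_symm_apply,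
    CosetGerm.coe_quotientEquivOrbit_mk]

/-- The same as an identity in `X^*(P^K)`: `(Γ/D ≃ Π)(ρD) = σ′π₀` for `σ′ ∘ τ₀ = τ₀ ∘ ρ`. [cite: Milne1999, §6 p. 70 L7–L8] -/
theorem quotientEquivWeilOrbitPiZero_mk (hn : (univ.filter (· ∈ Γ₀) : Finset (K ≃ₐ[ℚ] K)).card ≠ 2)
    (σ' : cmNumbers ≃ₐ[ℚ] cmNumbers) (ρ : K ≃ₐ[ℚ] K) (hρ : σ' • τ₀ = embOfAut τ₀ ρ) :
    (quotientEquivWeilOrbitPiZero p 𝔭 τ₀ h hn (ρ : (K ≃ₐ[ℚ] K) ⧸ decompositionGroup p 𝔭)).1 =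
      weilLimitInRep p τ₀ σ' (piZero p 𝔭 τ₀ h) :=
  germToCosetFun_injective p 𝔭 τ₀ (by
    rw [germToCosetFun_quotientEquivWeilOrbitPiZero_mk, germToCosetFun_weilLimitInRep_piZero p 𝔭 τ₀ h σ' ρ hρ])

omit [DecidablePred (· ∈ decompositionGroup p 𝔭)] in
/-- `Π` is finite. [cite: Milne1999, §6 p. 69 L26–L28] -/
instance finite_weilOrbitPiZero : Finite (weilOrbitPiZero p 𝔭 τ₀ h) :=
  Finite.of_equiv _ (weilOrbitPiZeroEquiv p 𝔭 τ₀ h).symm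

/-- **`|Π|·[K_{w₀} : ℚ_p] = [K : ℚ]`** («`Π = {π₀, …, π_{(n/d)−1}, ιπ₀, …, ιπ_{(n/d)−1}}`» has `2n/d` elements: `(D : 1) = [K_{w₀} : ℚ_p]` by g18-#1
`card_decompositionGroup`, `|Γ| = [K : ℚ]`), for `n ≠ 2`. [cite: Milne1999, §6 p. 69 L12–L17, L26–L28] -/
theorem card_weilOrbitPiZero_mul_localDegree (hn : (univ.filter (· ∈ Γ₀) : Finset (K ≃ₐ[ℚ] K)).card ≠ 2) :
    Nat.card (weilOrbitPiZero p 𝔭 τ₀ h) * localDegree 𝔭 = Module.finrank ℚ K := by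
  rw [← Nat.card_congr (quotientEquivWeilOrbitPiZero p 𝔭 τ₀ h hn), ← card_decompositionGroup p 𝔭, ← IsGalois.card_aut_eq_finrank,
    ← Subgroup.card_eq_card_quotient_mul_card_subgroup (decompositionGroup p 𝔭)]

end Germs

/-! ### §3 The instance `K = Q·F`, `p` split in `Q` (g18-#1 `cosetGermSetting`), with `n = [K : Q]` -/

section Split

variable {K : Type} [Field K] [NumberField K] [IsCMField K] [IsGalois ℚ K] (Q : IntermediateField ℚ K)
variable (p : ℕ) [hp : Fact p.Prime] (𝔭 : Ideal (𝓞 K)) [h𝔭P : 𝔭.IsPrime] [h𝔭 : 𝔭.LiesOver (Ideal.span {(p : ℤ)})]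
variable (τ₀ : K →ₐ[ℚ] cmNumbers)
variable [DecidableEq (K ≃ₐ[ℚ] K)] [DecidablePred (· ∈ Q.fixingSubgroup)] [DecidablePred (· ∈ decompositionGroup p 𝔭)]

omit [IsCMField K] hp h𝔭P h𝔭 [DecidableEq (K ≃ₐ[ℚ] K)] [DecidablePred (· ∈ decompositionGroup p 𝔭)] in
/-- `n = |Γ₀| = |Gal(K/Q)| = [K : Q]` (`= [F : ℚ]`). [cite: Milne1999, §6 p. 69 L1–L6] -/
theorem card_filter_mem_fixingSubgroup : (univ.filter (· ∈ Q.fixingSubgroup) : Finset (K ≃ₐ[ℚ] K)).card = Module.finrank Q K := by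
  rw [← IsGalois.card_fixingSubgroup_eq_finrank Q]
  exact (Nat.subtype_card _ fun x => by simp only [Finset.mem_filter, Finset.mem_univ, true_and]).symm

/-- **«`σ′π₀ = π₀ ⟺ σ′|_K ∈ D(w₀)`» for `K = Q·F`, `p` split in `Q`, `[K : Q] ≠ 2`** (`π₀ = π(ψ₀)` for the CM type `Φ₀ = {τ₀} ∪ τ₀ι(Gal(K/Q)∖1)`).
[cite: Milne1999, §6 p. 70 L7–L8, p. 69 L1–L17] -/
theorem weilLimitInRep_piZero_eq_iff_of_split (hQ : Module.finrank ℚ Q = 2) (hQi : ¬IsTotallyReal Q)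
    (hsplit : ((Ideal.span {(p : ℤ)}).primesOver (𝓞 Q)).ncard = 2) (hK : Module.finrank Q K ≠ 2)
    (σ' : cmNumbers ≃ₐ[ℚ] cmNumbers) (ρ : K ≃ₐ[ℚ] K) (hρ : σ' • τ₀ = embOfAut τ₀ ρ) :
    weilLimitInRep p τ₀ σ' (piZero p 𝔭 τ₀ (cosetGermSetting Q p 𝔭 hQ hQi hsplit)) =
        piZero p 𝔭 τ₀ (cosetGermSetting Q p 𝔭 hQ hQi hsplit) ↔ ρ ∈ decompositionGroup p 𝔭 :=
  weilLimitInRep_piZero_eq_iff p 𝔭 τ₀ _ (by rw [card_filter_mem_fixingSubgroup]; exact hK) σ' ρ hρ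

/-- **«The map `τ ↦ τπ₀` defines a bijection `Γ/D → Π`» for `K = Q·F`, `p` split in `Q`, `[K : Q] ≠ 2.** [cite: Milne1999, §6 p. 70 L7–L8] -/
def quotientEquivWeilOrbitPiZeroOfSplit (hQ : Module.finrank ℚ Q = 2) (hQi : ¬IsTotallyReal Q)
    (hsplit : ((Ideal.span {(p : ℤ)}).primesOver (𝓞 Q)).ncard = 2) (hK : Module.finrank Q K ≠ 2) :
    (K ≃ₐ[ℚ] K) ⧸ decompositionGroup p 𝔭 ≃ weilOrbitPiZero p 𝔭 τ₀ (cosetGermSetting Q p 𝔭 hQ hQi hsplit) :=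
  quotientEquivWeilOrbitPiZero p 𝔭 τ₀ _ (by rw [card_filter_mem_fixingSubgroup]; exact hK)

/-- **`|Π|·[K_{w₀} : ℚ_p] = [K : ℚ] = 2n`** for `K = Q·F`, `p` split in `Q`, `n = [K : Q] ≠ 2`. [cite: Milne1999, §6 p. 69 L12–L17, L26–L28] -/
theorem card_weilOrbitPiZero_mul_localDegree_of_split (hQ : Module.finrank ℚ Q = 2) (hQi : ¬IsTotallyReal Q)
    (hsplit : ((Ideal.span {(p : ℤ)}).primesOver (𝓞 Q)).ncard = 2) (hK : Module.finrank Q K ≠ 2) :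
    Nat.card (weilOrbitPiZero p 𝔭 τ₀ (cosetGermSetting Q p 𝔭 hQ hQi hsplit)) * localDegree 𝔭 = Module.finrank ℚ K :=
  card_weilOrbitPiZero_mul_localDegree p 𝔭 τ₀ _ (by rw [card_filter_mem_fixingSubgroup]; exact hK)

end Split

end CMNumbers

end Literature.NumberTheory.ComplexMultiplication
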